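import Literature.MathematicalPhysics.QuantumFieldTheory.Chatterjee2026YMHiggs.U1HiggsScalingLimit
import Literature.MathematicalPhysics.QuantumFieldTheory.SU2HiggsKeyEstimate
import Literature.MathematicalPhysics.QuantumFieldTheory.CircleHaarAngle
import Mathlib.Analysis.SpecialFunctions.Trigonometric.Bounds
import HarnessLib

/-!
# Chatterjee's key estimate for `U(1)` theory (Lemma 5.10), proved

S. Chatterjee, *A scaling limit of `SU(2)` lattice Yang–Mills–Higgs theory*, Probab. Math.
Phys. **7** (2026) 339–381, arXiv:2401.10507 [Chatterjee2026YMHiggs], §5.6, **Lemma 5.10**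
(arXiv v4 numbering): for the unitary-gauge `U(1)` theory on the torus,
`E|1 − V_e|² ≤ C/(α⁴g²) + C log α/α²` for `α ≥ 2`, `αg ≤ 1`, `C = C(d)` — uniformly in the volume.
The source proves it "exactly like" the `SU(2)` key estimate Lemma 5.5 (§5.3), which the tree
PROVES with explicit constants in `SU2HiggsKeyEstimate` (`integral_su2Deficit_le_keyEstimate`).
This file DISCHARGES the named fact `Chatterjee2026YMHiggs.u1Higgs_keyEstimate` of
`U1HiggsScalingLimit` (D-0014) by porting that proof, step for step, from `SU(2)` to `U(1)`:

  `integral_u1Deficit_le_keyEstimate`: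
  `E[1 − Re U_{(x,i)}] ≤ 16 d²/(g² α⁴) + (d + d log (π α))/α²`  for `α ≥ 1`,

every `d`, `L ≥ 1`, real `g` and edge `(x, i)`, whence (`|1 − z|² = 2 (1 − Re z)`, `α ≥ 2`)
`u1Higgs_keyEstimate_holds` with `C(d) = 32 d² + 2 d + 2 d (1 + log π)/log 2`.

## Contents and proof (as in print, §5.3/§5.6; cf. `SU2HiggsKeyEstimate`)

* `u1Deficit z = 1 − Re z ∈ [0, 2]` (`|1 − z|² = 2 t(z)`, `norm_one_sub_coe_sq`), the Hamiltonian
  `u1HiggsH g α U = g⁻² ∑ₚ t(U_p) + α² ∑ₑ t(U_e)` (the printed constants of (1.1)/Lemma 5.3: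
  `β = g⁻²`, edge coefficient `α²`); `u1HiggsWeight_eq_smul_u1GibbsWeight`,
  `u1HiggsMeasure_eq_gibbs`: `u1HiggsMeasure L g α = Z⁻¹ • e^{−H} ∏ₑ dU_e`, in particular it is
  a probability measure (`isProbabilityMeasure_u1HiggsMeasure`).
* Gibbs identity `E[e^{H}] = 1/Z` and Jensen `E[H] ≤ log(1/Z)` (`integral_u1HiggsH_le_log`).
* Translation invariance (`u1HiggsMeasure_map_torusConfigShift`), hence
  `α² |Λ| E[t(U_{(x,i)})] ≤ E[H]` (`card_mul_integral_u1Deficit_le`).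
* Plaquette bound `t(U_p) ≤ 16 η` on `Σ' = {t(U_e) ≤ η ∀e}` (`|1 − zw| ≤ |1 − z| + |1 − w|` on the
  unit circle), `π(Σ') = Haar(T_η)^{|E|}` with the arc `T_η = {1 − Re z ≤ η} ⊇ {|θ| ≤ √η}` of
  normalised length `≥ √η/π` (`le_haar_u1DeficitBall`, via the angle parametrisation
  `CircleHaar.map_exp_angleMeasure` and `1 − θ²/2 ≤ cos θ`), so
  `log(1/Z) ≤ g⁻² 16η|P| + α²η|E| + |E| log(π/√η)` (`log_inv_u1GibbsZ_le`).
* Assembly with `η = α⁻²`, `|E| = d|Λ|`, `|P| ≤ d²|Λ|` (`card_edge`, `card_plaquette_le` of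
  `SU2HiggsKeyEstimate`).

Chatterjee's hypothesis `αg ≤ 1` is carried by the fact but not needed. No named facts are
introduced; the definitions are the `U(1)` counterparts of those of `SU2HiggsKeyEstimate`.
-/

noncomputable section

open MeasureTheory Filter Topology
open scoped ENNReal
open Literature.MathematicalPhysics.QuantumLattice

namespace Literature.MathematicalPhysics.QuantumFieldTheory.Chatterjee2026YMHiggs

variable {d : ℕ}

/-! ### The deficit `1 − Re z` on `U(1)` and the Hamiltonian -/

/-- The deficit `t(z) = 1 − Re z ∈ [0, 2]` of `z ∈ U(1)`; `|1 − z|² = 2 t(z)` (Chatterjee §5.6: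
`|1 − U_p|² = 2 − 2 Re(U_p)`). [cite: Chatterjee2026YMHiggs, §5.6 (proof of Lemma 5.10)] -/
def u1Deficit (z : Circle) : ℝ := 1 - (z : ℂ).re

/-- `z ↦ t(z)` is continuous. [folklore] -/
private theorem continuous_u1Deficit : Continuous u1Deficit :=
  continuous_const.sub (Complex.continuous_re.comp continuous_subtype_val)

/-- `0 ≤ t(z)` (`Re z ≤ |z| = 1`). [cite: Chatterjee2026YMHiggs, §5.6 (proof of Lemma 5.10)] -/
theorem u1Deficit_nonneg (z : Circle) : 0 ≤ u1Deficit z := by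
  have h := (Complex.abs_re_le_norm (z : ℂ)).trans_eq (Circle.norm_coe z)
  unfold u1Deficit
  linarith [(abs_le.1 h).2]

/-- `t(z) ≤ 2` (`−1 ≤ Re z`). [cite: Chatterjee2026YMHiggs, §5.6 (proof of Lemma 5.10)] -/
theorem u1Deficit_le_two (z : Circle) : u1Deficit z ≤ 2 := by
  have h := (Complex.abs_re_le_norm (z : ℂ)).trans_eq (Circle.norm_coe z)
  unfold u1Deficit
  linarith [(abs_le.1 h).1]

/-- `|1 − z|² = 2 t(z)` on the unit circle (Chatterjee: `|1 − U_p|² = 2 − 2Re(U_p)`).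
[cite: Chatterjee2026YMHiggs, §5.6 (proof of Lemma 5.10)] -/
theorem norm_one_sub_coe_sq (z : Circle) : ‖(1 : ℂ) - (z : ℂ)‖ ^ 2 = 2 * u1Deficit z := by
  have h := Circle.normSq_coe z
  rw [Complex.normSq_apply] at h
  rw [Complex.sq_norm, Complex.normSq_apply, u1Deficit]
  simp only [Complex.sub_re, Complex.one_re, Complex.sub_im, Complex.one_im, zero_sub]
  nlinarith [h]

/-- `Re tr u1Rep(z) = Re z` (trace of a `1 × 1` matrix; a private copy of
`U1GinibreComparison.trace_u1Rep_re`, whose module is not in this file's import cone). [folklore] -/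
private theorem trace_u1Rep_re' (z : Circle) : (u1Rep z).trace.re = (z : ℂ).re := by
  simp [u1Rep_apply, Matrix.scalar_apply, Matrix.trace]

variable {L : ℕ} [NeZero L]

/-- Chatterjee's Hamiltonian of the unitary-gauge `U(1)` Yang–Mills–Higgs theory with the
printed constants of (1.1): `H(U) = g⁻² ∑ₚ t(U_p) + α² ∑ₑ t(U_e)`, `t = 1 − Re`, so that
`u1HiggsWeight` has density `∝ e^{−H}` against product Haar measure (§5.6: "`S(U) =` const `− H(U)`
with `H(U) = (2g²)⁻¹ ∑ₚ |1 − U_p|² + (α²/2) ∑ₑ |1 − U_e|²`" and `|1 − U|² = 2t(U)`).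
[cite: Chatterjee2026YMHiggs, §5.6 (the Hamiltonian H, proof of Lemma 5.10)] -/
def u1HiggsH (g α : ℝ) (U : GaugeConfig d L Circle) : ℝ :=
  (g ^ 2)⁻¹ * ∑ p : Plaquette d L, u1Deficit (plaquetteHolonomy U p.1 p.2.1.1 p.2.1.2) +
    α ^ 2 * ∑ e : Edge d L, u1Deficit (U e)

/-- `H ≥ 0`. [cite: Chatterjee2026YMHiggs, §5.6 (proof of Lemma 5.10)] -/
theorem u1HiggsH_nonneg (g α : ℝ) (U : GaugeConfig d L Circle) : 0 ≤ u1HiggsH g α U :=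
  add_nonneg
    (mul_nonneg (inv_nonneg.2 (by positivity))
      (Finset.sum_nonneg fun p _ => u1Deficit_nonneg _))
    (mul_nonneg (by positivity) (Finset.sum_nonneg fun e _ => u1Deficit_nonneg _))

/-- `H` is continuous on the compact configuration space. [folklore] -/
private theorem continuous_u1HiggsH (g α : ℝ) : Continuous (u1HiggsH (d := d) (L := L) g α) := by
  unfold u1HiggsH
  refine (continuous_const.mul (continuous_finsetSum _ fun p _ => ?_)).add
    (continuous_const.mul (continuous_finsetSum _ fun e _ =>
      continuous_u1Deficit.comp (continuous_apply e)))
  refine continuous_u1Deficit.comp ?_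
  unfold plaquetteHolonomy
  fun_prop

/-- `H` is measurable (product σ-algebra = Borel σ-algebra, `U(1)` second countable). [folklore] -/
private theorem measurable_u1HiggsH (g α : ℝ) : Measurable (u1HiggsH (d := d) (L := L) g α) :=
  (continuous_u1HiggsH g α).measurable

/-- The Gibbs density `e^{−H}` is measurable. [folklore] -/
private theorem measurable_exp_neg_u1HiggsH (g α : ℝ) :
    Measurable fun U : GaugeConfig d L Circle => ENNReal.ofReal (Real.exp (-u1HiggsH g α U)) :=
  ENNReal.measurable_ofReal.comp (Real.measurable_exp.comp (measurable_u1HiggsH g α).neg)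

/-- `e^{H}` is measurable. [folklore] -/
private theorem measurable_exp_u1HiggsH (g α : ℝ) :
    Measurable fun U : GaugeConfig d L Circle => ENNReal.ofReal (Real.exp (u1HiggsH g α U)) :=
  ENNReal.measurable_ofReal.comp (Real.measurable_exp.comp (measurable_u1HiggsH g α))

/-- `H` is bounded: `H ≤ g⁻² · 2|P| + α² · 2|E|`. [cite: Chatterjee2026YMHiggs, §5.6 (proof of Lemma 5.10)] -/
theorem u1HiggsH_le (g α : ℝ) (U : GaugeConfig d L Circle) :
    u1HiggsH g α U ≤ (g ^ 2)⁻¹ * (2 * Fintype.card (Plaquette d L)) +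
      α ^ 2 * (2 * Fintype.card (Edge d L)) := by
  unfold u1HiggsH
  gcongr
  · calc ∑ p : Plaquette d L, u1Deficit (plaquetteHolonomy U p.1 p.2.1.1 p.2.1.2)
        ≤ ∑ _p : Plaquette d L, (2 : ℝ) := Finset.sum_le_sum fun p _ => u1Deficit_le_two _
      _ = 2 * Fintype.card (Plaquette d L) := by simp [mul_comm]
  · calc ∑ e : Edge d L, u1Deficit (U e)
        ≤ ∑ _e : Edge d L, (2 : ℝ) := Finset.sum_le_sum fun e _ => u1Deficit_le_two _
      _ = 2 * Fintype.card (Edge d L) := by simp [mul_comm]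

/-! ### The Gibbs measure of `H` and its identification with `u1HiggsMeasure` -/

/-- Product Haar measure on `U(1)`-configurations of the torus. [cite: Chatterjee2026YMHiggs, §1.3 (product Haar measure on U(1)^E)] -/
def u1HaarPi (d L : ℕ) [NeZero L] : Measure (GaugeConfig d L Circle) :=
  Measure.pi fun _ : Edge d L => haarProbability Circle

/-- Product Haar measure is a probability measure. [folklore] -/
private theorem isProbabilityMeasure_u1HaarPi : IsProbabilityMeasure (u1HaarPi d L) := by
  unfold u1HaarPi; infer_instance

/-- The Gibbs weight `e^{−H} ∏ₑ dU_e`. [cite: Chatterjee2026YMHiggs, §5.6 (density of V proportional to e^{−H})] -/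
def u1GibbsWeight (g α : ℝ) : Measure (GaugeConfig d L Circle) :=
  (u1HaarPi d L).withDensity fun U => ENNReal.ofReal (Real.exp (-u1HiggsH g α U))

/-- The partition function `Z = ∫ e^{−H} ∏ₑ dU_e`. [cite: Chatterjee2026YMHiggs, §5.6 (proof of Lemma 5.10, via §5.3)] -/
def u1GibbsZ (d L : ℕ) [NeZero L] (g α : ℝ) : ℝ≥0∞ := u1GibbsWeight (d := d) (L := L) g α Set.univ

/-- `Z` as a lower Lebesgue integral. [folklore] -/
private theorem u1GibbsZ_eq_lintegral (g α : ℝ) :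
    u1GibbsZ d L g α = ∫⁻ U, ENNReal.ofReal (Real.exp (-u1HiggsH g α U)) ∂u1HaarPi d L := by
  rw [u1GibbsZ, u1GibbsWeight, withDensity_apply _ MeasurableSet.univ, Measure.restrict_univ]

/-- `Z ≤ 1` (since `H ≥ 0` and product Haar is a probability measure). [cite: Chatterjee2026YMHiggs, §5.6 (proof of Lemma 5.10)] -/
theorem u1GibbsZ_le_one (g α : ℝ) : u1GibbsZ d L g α ≤ 1 := by
  haveI := isProbabilityMeasure_u1HaarPi (d := d) (L := L)
  rw [u1GibbsZ_eq_lintegral]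
  calc ∫⁻ U, ENNReal.ofReal (Real.exp (-u1HiggsH g α U)) ∂u1HaarPi d L
      ≤ ∫⁻ _U, 1 ∂u1HaarPi d L := lintegral_mono fun U => by
        rw [← ENNReal.ofReal_one]
        exact ENNReal.ofReal_le_ofReal
          (Real.exp_le_one_iff.2 (by linarith [u1HiggsH_nonneg g α U]))
    _ = 1 := by simp

/-- `Z ≠ ⊤`. [folklore] -/
private theorem u1GibbsZ_ne_top (g α : ℝ) : u1GibbsZ d L g α ≠ ∞ :=
  ne_top_of_le_ne_top ENNReal.one_ne_top (u1GibbsZ_le_one g α)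

/-- Crude positivity: `Z ≥ e^{−sup H} > 0`. [cite: Chatterjee2026YMHiggs, §5.6 (proof of Lemma 5.10)] -/
theorem exp_neg_le_u1GibbsZ (g α : ℝ) :
    ENNReal.ofReal (Real.exp (-((g ^ 2)⁻¹ * (2 * Fintype.card (Plaquette d L)) +
      α ^ 2 * (2 * Fintype.card (Edge d L))))) ≤ u1GibbsZ d L g α := by
  haveI := isProbabilityMeasure_u1HaarPi (d := d) (L := L)
  rw [u1GibbsZ_eq_lintegral]
  calc _ = ∫⁻ _U, ENNReal.ofReal (Real.exp (-((g ^ 2)⁻¹ * (2 * Fintype.card (Plaquette d L)) +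
      α ^ 2 * (2 * Fintype.card (Edge d L))))) ∂u1HaarPi d L := by
        rw [lintegral_const, measure_univ, mul_one]
    _ ≤ _ := lintegral_mono fun U => ENNReal.ofReal_le_ofReal
        (Real.exp_le_exp.2 (neg_le_neg (u1HiggsH_le g α U)))

/-- `Z ≠ 0`. [folklore] -/
private theorem u1GibbsZ_ne_zero (g α : ℝ) : u1GibbsZ d L g α ≠ 0 :=
  (lt_of_lt_of_le (ENNReal.ofReal_pos.2 (Real.exp_pos _)) (exp_neg_le_u1GibbsZ g α)).ne'

/-- The exponent of `u1HiggsWeight` is `α²|E| − H`: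
`−g⁻² S_W(U) + α² ∑ₑ Re U_e = α² |E| − H(U)` (§5.6: "`S(U) = |P|/g² + |E|α² − H(U)`", the
`|P|/g²` being already subtracted in Wave 0's `wilsonAction = ∑ₚ (1 − Re U_p)`).
[cite: Chatterjee2026YMHiggs, §5.6 (proof of Lemma 5.10: S(U) = const − H(U))] -/
theorem neg_wilsonAction_add_edge_eq (g α : ℝ) (U : GaugeConfig d L Circle) :
    -(g ^ 2)⁻¹ * wilsonAction u1Rep U + α ^ 2 * ∑ e : Edge d L, ((U e : Circle) : ℂ).re =
      α ^ 2 * Fintype.card (Edge d L) - u1HiggsH g α U := by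
  have hW : wilsonAction u1Rep U =
      ∑ p : Plaquette d L, u1Deficit (plaquetteHolonomy U p.1 p.2.1.1 p.2.1.2) := by
    unfold wilsonAction u1Deficit
    refine Finset.sum_congr rfl fun p _ => ?_
    rw [trace_u1Rep_re']
    simp
  have hE : ∑ e : Edge d L, ((U e : Circle) : ℂ).re =
      Fintype.card (Edge d L) - ∑ e : Edge d L, u1Deficit (U e) := by
    simp only [u1Deficit, Finset.sum_sub_distrib, Finset.sum_const, Finset.card_univ, nsmul_eq_mul,
      mul_one]
    ring
  rw [hW, hE, u1HiggsH]
  ring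

/-- **`u1HiggsWeight` is `e^{α²|E|}` times the Gibbs weight `e^{−H} ∏ dU_e`.**
[cite: Chatterjee2026YMHiggs, §5.6 (proof of Lemma 5.10: density of V ∝ e^{−H})] -/
theorem u1HiggsWeight_eq_smul_u1GibbsWeight (g α : ℝ) :
    u1HiggsWeight (d := d) L g α =
      ENNReal.ofReal (Real.exp (α ^ 2 * Fintype.card (Edge d L))) • u1GibbsWeight g α := by
  have hm1 : Measurable fun U : GaugeConfig d L Circle =>
      ENNReal.ofReal (Real.exp (-(g ^ 2)⁻¹ * wilsonAction u1Rep U)) :=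
    ENNReal.measurable_ofReal.comp (Real.measurable_exp.comp
      (measurable_const.mul (measurable_wilsonAction u1Rep continuous_u1Rep)))
  have hm2 : Measurable fun U : GaugeConfig d L Circle =>
      ENNReal.ofReal (Real.exp (α ^ 2 * ∑ e : Edge d L, ((U e : Circle) : ℂ).re)) := by
    refine ENNReal.measurable_ofReal.comp (Real.measurable_exp.comp (measurable_const.mul ?_))
    refine Finset.measurable_sum _ fun e _ => ?_
    have hre : Continuous fun z : Circle => (z : ℂ).re :=
      Complex.continuous_re.comp continuous_subtype_val
    exact hre.measurable.comp (measurable_pi_apply e)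
  unfold u1HiggsWeight wilsonWeight u1GibbsWeight u1HaarPi
  rw [← withDensity_mul _ hm1 hm2, ← withDensity_smul _ (measurable_exp_neg_u1HiggsH g α)]
  congr 1
  funext U
  simp only [Pi.mul_apply, Pi.smul_apply, smul_eq_mul]
  rw [← ENNReal.ofReal_mul (Real.exp_pos _).le, ← ENNReal.ofReal_mul (Real.exp_pos _).le,
    ← Real.exp_add, ← Real.exp_add, neg_wilsonAction_add_edge_eq, sub_eq_add_neg]

/-- **The unitary-gauge `U(1)` YMH measure is the Gibbs measure of `H`**:
`u1HiggsMeasure L g α = Z⁻¹ • e^{−H} ∏ₑ dU_e` (§5.6: "the probability density of `V` is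
proportional to `e^{−H(U)}`"). [cite: Chatterjee2026YMHiggs, §5.6 (proof of Lemma 5.10)] -/
theorem u1HiggsMeasure_eq_gibbs (g α : ℝ) :
    u1HiggsMeasure (d := d) L g α = (u1GibbsZ d L g α)⁻¹ • u1GibbsWeight g α := by
  set C : ℝ≥0∞ := ENNReal.ofReal (Real.exp (α ^ 2 * Fintype.card (Edge d L))) with hC
  have hC0 : C ≠ 0 := (ENNReal.ofReal_pos.2 (Real.exp_pos _)).ne'
  have hCt : C ≠ ∞ := ENNReal.ofReal_ne_top
  unfold u1HiggsMeasure
  rw [u1HiggsWeight_eq_smul_u1GibbsWeight, Measure.smul_apply, smul_eq_mul, smul_smul]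
  congr 1
  rw [← hC, show C * u1GibbsWeight g α Set.univ = C * u1GibbsZ d L g α from rfl,
    ENNReal.mul_inv (Or.inl hC0) (Or.inl hCt), mul_comm C⁻¹, mul_assoc,
    ENNReal.inv_mul_cancel hC0 hCt, mul_one]

/-- **`u1HiggsMeasure L g α` is a probability measure** for every `L ≥ 1` and all real `g, α`
(`0 < Z < ∞`), as anticipated in its docstring. [cite: Chatterjee2026YMHiggs, §1.3 (the probability measure μ) and Lemma 5.3] -/
theorem isProbabilityMeasure_u1HiggsMeasure (g α : ℝ) :
    IsProbabilityMeasure (u1HiggsMeasure (d := d) L g α) := by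
  constructor
  rw [u1HiggsMeasure_eq_gibbs, Measure.smul_apply, smul_eq_mul,
    show u1GibbsWeight g α Set.univ = u1GibbsZ d L g α from rfl]
  exact ENNReal.inv_mul_cancel (u1GibbsZ_ne_zero g α) (u1GibbsZ_ne_top g α)

/-- Expectations under the YMH measure as Gibbs averages:
`∫⁻ F dμ = Z⁻¹ ∫⁻ F e^{−H} ∏ dU_e`. [folklore] -/
private theorem lintegral_u1HiggsMeasure (g α : ℝ) {F : GaugeConfig d L Circle → ℝ≥0∞}
    (hF : Measurable F) :
    ∫⁻ U, F U ∂u1HiggsMeasure (d := d) L g α =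
      (u1GibbsZ d L g α)⁻¹ *
        ∫⁻ U, F U * ENNReal.ofReal (Real.exp (-u1HiggsH g α U)) ∂u1HaarPi d L := by
  rw [u1HiggsMeasure_eq_gibbs, lintegral_smul_measure, u1GibbsWeight,
    lintegral_withDensity_eq_lintegral_mul _ (measurable_exp_neg_u1HiggsH g α) hF, smul_eq_mul]
  congr 1
  exact lintegral_congr fun U => by simp [mul_comm]

/-- **The Gibbs identity** `E[e^{H}] = 1/Z` ("`1/∫ p(U) ∏ dU_e = E(p(V)⁻¹)`", proof of Lemma 5.5,
invoked for `U(1)` in §5.6). [cite: Chatterjee2026YMHiggs, §5.6 (proof of Lemma 5.10, as in Lemma 5.5)] -/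
theorem lintegral_exp_u1HiggsH (g α : ℝ) :
    ∫⁻ U, ENNReal.ofReal (Real.exp (u1HiggsH g α U)) ∂u1HiggsMeasure (d := d) L g α =
      (u1GibbsZ d L g α)⁻¹ := by
  haveI := isProbabilityMeasure_u1HaarPi (d := d) (L := L)
  rw [lintegral_u1HiggsMeasure g α (measurable_exp_u1HiggsH g α)]
  have h1 : ∀ U : GaugeConfig d L Circle, ENNReal.ofReal (Real.exp (u1HiggsH g α U)) *
      ENNReal.ofReal (Real.exp (-u1HiggsH g α U)) = 1 := fun U => by
    rw [← ENNReal.ofReal_mul (Real.exp_pos _).le, ← Real.exp_add, add_neg_cancel, Real.exp_zero,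
      ENNReal.ofReal_one]
  simp only [h1, lintegral_const, measure_univ, mul_one]

/-- Bochner form of the Gibbs identity: `∫ e^{H} dμ = (1/Z).toReal`. [folklore] -/
private theorem integral_exp_u1HiggsH (g α : ℝ) :
    ∫ U, Real.exp (u1HiggsH g α U) ∂u1HiggsMeasure (d := d) L g α =
      ((u1GibbsZ d L g α)⁻¹).toReal := by
  rw [integral_eq_lintegral_of_nonneg_ae (ae_of_all _ fun U => (Real.exp_pos _).le)
    ((Real.measurable_exp.comp (measurable_u1HiggsH g α)).aestronglyMeasurable),
    lintegral_exp_u1HiggsH]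

/-- **Jensen step**: `E[H] ≤ log E[e^{H}] = log (1/Z)` (the source bounds `E[H]` by the
layer-cake integral of `P(H ≥ t) ≤ e^{−t} E e^{H}`; Jensen gives the same bound without the
additive constant). [cite: Chatterjee2026YMHiggs, §5.6 (proof of Lemma 5.10, as in Lemma 5.5)] -/
theorem integral_u1HiggsH_le_log (g α : ℝ) :
    ∫ U, u1HiggsH g α U ∂u1HiggsMeasure (d := d) L g α ≤
      Real.log (((u1GibbsZ d L g α)⁻¹).toReal) := by
  haveI : IsProbabilityMeasure (u1HiggsMeasure (d := d) L g α) :=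
    isProbabilityMeasure_u1HiggsMeasure (d := d) (L := L) g α
  set μ := u1HiggsMeasure (d := d) L g α with hμ
  have hHm := measurable_u1HiggsH (d := d) (L := L) g α
  have hB := u1HiggsH_le (d := d) (L := L) g α
  set B : ℝ := (g ^ 2)⁻¹ * (2 * Fintype.card (Plaquette d L)) +
      α ^ 2 * (2 * Fintype.card (Edge d L)) with hBdef
  have hfi : Integrable (fun U => Real.exp (u1HiggsH g α U)) μ := by
    refine Integrable.of_mem_Icc 1 (Real.exp B) (Real.measurable_exp.comp hHm).aemeasurable
      (ae_of_all _ fun U => ⟨?_, ?_⟩)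
    · exact Real.one_le_exp (u1HiggsH_nonneg g α U)
    · exact Real.exp_le_exp.2 (hB U)
  have hgi : Integrable (Real.log ∘ fun U : GaugeConfig d L Circle => Real.exp (u1HiggsH g α U)) μ := by
    have : (Real.log ∘ fun U : GaugeConfig d L Circle => Real.exp (u1HiggsH g α U)) =
        u1HiggsH g α := by
      funext U; simp
    rw [this]
    exact Integrable.of_mem_Icc 0 B hHm.aemeasurable
      (ae_of_all _ fun U => ⟨u1HiggsH_nonneg g α U, hB U⟩)
  have hconc : ConcaveOn ℝ (Set.Ici (1 : ℝ)) Real.log :=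
    strictConcaveOn_log_Ioi.concaveOn.subset (Set.Ici_subset_Ioi.2 one_pos) (convex_Ici 1)
  have hcont : ContinuousOn Real.log (Set.Ici (1 : ℝ)) :=
    Real.continuousOn_log.mono fun x hx => ne_of_gt (lt_of_lt_of_le one_pos hx)
  have hJ := hconc.le_map_integral hcont isClosed_Ici
    (ae_of_all _ fun U => Real.one_le_exp (u1HiggsH_nonneg g α U)) hfi hgi
  simp only [Real.log_exp] at hJ
  rwa [integral_exp_u1HiggsH] at hJ

/-! ### Translation invariance -/

/-- `H` is invariant under torus translations. [cite: Chatterjee2026YMHiggs, §5.6 (periodic boundary: "by symmetry", as in the proof of Lemma 5.5)] -/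
theorem u1HiggsH_torusConfigShift (g α : ℝ) (v : Site d L) (U : GaugeConfig d L Circle) :
    u1HiggsH g α (torusConfigShift v U) = u1HiggsH g α U := by
  have hP : ∑ p : Plaquette d L,
      u1Deficit (plaquetteHolonomy (torusConfigShift v U) p.1 p.2.1.1 p.2.1.2) =
      ∑ p : Plaquette d L, u1Deficit (plaquetteHolonomy U p.1 p.2.1.1 p.2.1.2) := by
    simp only [plaquetteHolonomy_torusConfigShift]
    exact Fintype.sum_equiv ((Equiv.subRight v).prodCongr (Equiv.refl _)) _ _ fun p => rfl
  have hE : ∑ e : Edge d L, u1Deficit (torusConfigShift v U e) =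
      ∑ e : Edge d L, u1Deficit (U e) := by
    simp only [torusConfigShift_apply]
    exact Fintype.sum_equiv ((Equiv.subRight v).prodCongr (Equiv.refl _)) _ _ fun e => rfl
  unfold u1HiggsH
  rw [hP, hE]

/-- Product Haar measure is invariant under torus translations (a permutation of the factors).
[folklore] -/
private theorem u1HaarPi_map_torusConfigShift (v : Site d L) :
    (u1HaarPi d L).map (torusConfigShift v) = u1HaarPi d L :=
  (measurePreserving_arrowCongr' (fun _ : Edge d L => haarProbability Circle)
    (fun _ : Edge d L => haarProbability Circle) (torusEdgeShift v) (MeasurableEquiv.refl Circle)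
    fun _ => MeasurePreserving.id _).map_eq

/-- The Gibbs weight is invariant under torus translations. [folklore] -/
private theorem u1GibbsWeight_map_torusConfigShift (g α : ℝ) (v : Site d L) :
    (u1GibbsWeight (d := d) (L := L) g α).map (torusConfigShift v) = u1GibbsWeight g α := by
  unfold u1GibbsWeight
  rw [withDensity_map_of_measurableEquiv _ _ _ (u1HaarPi_map_torusConfigShift v)]
  intro U
  rw [u1HiggsH_torusConfigShift]

/-- **The unitary-gauge `U(1)` YMH measure is translation invariant** ("by symmetry (due to
periodic boundary)", proof of Lemma 5.5, used verbatim for `U(1)` in §5.6).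
[cite: Chatterjee2026YMHiggs, §5.6 (proof of Lemma 5.10, as in Lemma 5.5)] -/
theorem u1HiggsMeasure_map_torusConfigShift (g α : ℝ) (v : Site d L) :
    (u1HiggsMeasure (d := d) L g α).map (torusConfigShift v) = u1HiggsMeasure L g α := by
  rw [u1HiggsMeasure_eq_gibbs, Measure.map_smul, u1GibbsWeight_map_torusConfigShift]

/-- Single-edge expectations do not depend on the base point of the edge. [folklore] -/
private theorem lintegral_edge_eq (g α : ℝ) (F : Circle → ℝ≥0∞) (hF : Measurable F) (i : Fin d)
    (x y : Site d L) :
    ∫⁻ U, F (U (x, i)) ∂u1HiggsMeasure (d := d) L g α =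
      ∫⁻ U, F (U (y, i)) ∂u1HiggsMeasure (d := d) L g α := by
  have hmeas : ∀ z : Site d L, Measurable fun U : GaugeConfig d L Circle => F (U (z, i)) :=
    fun z => hF.comp (measurable_pi_apply _)
  calc ∫⁻ U, F (U (x, i)) ∂u1HiggsMeasure (d := d) L g α
      = ∫⁻ U, F (U (x, i)) ∂(u1HiggsMeasure (d := d) L g α).map (torusConfigShift (x - y)) := by
        rw [u1HiggsMeasure_map_torusConfigShift]
    _ = ∫⁻ U, F ((torusConfigShift (x - y) U) (x, i)) ∂u1HiggsMeasure (d := d) L g α :=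
        lintegral_map (hmeas x) (torusConfigShift (x - y)).measurable
    _ = ∫⁻ U, F (U (y, i)) ∂u1HiggsMeasure (d := d) L g α := by
        congr 1; funext U
        rw [torusConfigShift_apply, sub_sub_cancel]

/-- Bochner form of `lintegral_edge_eq` for the deficit: `E[t(U_{(x,i)})] = E[t(U_{(y,i)})]`.
[cite: Chatterjee2026YMHiggs, §5.6 (proof of Lemma 5.10: translation invariance)] -/
theorem integral_u1Deficit_edge_eq (g α : ℝ) (i : Fin d) (x y : Site d L) :
    ∫ U, u1Deficit (U (x, i)) ∂u1HiggsMeasure (d := d) L g α =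
      ∫ U, u1Deficit (U (y, i)) ∂u1HiggsMeasure (d := d) L g α := by
  have hmeas : ∀ z : Site d L, Measurable fun U : GaugeConfig d L Circle => u1Deficit (U (z, i)) :=
    fun z => continuous_u1Deficit.measurable.comp (measurable_pi_apply _)
  rw [integral_eq_lintegral_of_nonneg_ae (ae_of_all _ fun U => u1Deficit_nonneg _)
      (hmeas x).aestronglyMeasurable,
    integral_eq_lintegral_of_nonneg_ae (ae_of_all _ fun U => u1Deficit_nonneg _)
      (hmeas y).aestronglyMeasurable,
    lintegral_edge_eq g α (fun V => ENNReal.ofReal (u1Deficit V))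
      (ENNReal.measurable_ofReal.comp continuous_u1Deficit.measurable) i x y]

/-- The Higgs term dominates the deficit of the edges in one direction:
`α² ∑ₓ t(U_{(x,i)}) ≤ H(U)`. [cite: Chatterjee2026YMHiggs, §5.6 (proof of Lemma 5.10)] -/
theorem sum_u1Deficit_dir_le_u1HiggsH (g α : ℝ) (i : Fin d) (U : GaugeConfig d L Circle) :
    α ^ 2 * ∑ x : Site d L, u1Deficit (U (x, i)) ≤ u1HiggsH g α U := by
  unfold u1HiggsH
  have h1 : ∑ x : Site d L, u1Deficit (U (x, i)) ≤ ∑ e : Edge d L, u1Deficit (U e) := by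
    rw [Fintype.sum_prod_type]
    exact Finset.sum_le_sum fun x _ =>
      Finset.single_le_sum (f := fun j => u1Deficit (U (x, j))) (fun j _ => u1Deficit_nonneg _)
        (Finset.mem_univ i)
  have h2 : 0 ≤ (g ^ 2)⁻¹ * ∑ p : Plaquette d L,
      u1Deficit (plaquetteHolonomy U p.1 p.2.1.1 p.2.1.2) :=
    mul_nonneg (inv_nonneg.2 (by positivity)) (Finset.sum_nonneg fun p _ => u1Deficit_nonneg _)
  nlinarith [mul_le_mul_of_nonneg_left h1 (by positivity : (0 : ℝ) ≤ α ^ 2)]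

/-- **Mean deficit of an edge in terms of the partition function**:
`α² · |Λ| · E[t(U_{(x,i)})] ≤ E[H] ≤ log (1/Z)`. [cite: Chatterjee2026YMHiggs, §5.6 (proof of Lemma 5.10)] -/
theorem card_mul_integral_u1Deficit_le (g α : ℝ) (i : Fin d) (x : Site d L) :
    α ^ 2 * (Fintype.card (Site d L) *
        ∫ U, u1Deficit (U (x, i)) ∂u1HiggsMeasure (d := d) L g α) ≤
      Real.log (((u1GibbsZ d L g α)⁻¹).toReal) := by
  haveI : IsProbabilityMeasure (u1HiggsMeasure (d := d) L g α) :=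
    isProbabilityMeasure_u1HiggsMeasure (d := d) (L := L) g α
  set μ := u1HiggsMeasure (d := d) L g α with hμ
  have hmeas : ∀ z : Site d L, Measurable fun U : GaugeConfig d L Circle => u1Deficit (U (z, i)) :=
    fun z => continuous_u1Deficit.measurable.comp (measurable_pi_apply _)
  have hint : ∀ z : Site d L, Integrable (fun U : GaugeConfig d L Circle => u1Deficit (U (z, i))) μ :=
    fun z => Integrable.of_mem_Icc 0 2 (hmeas z).aemeasurable
      (ae_of_all _ fun U => ⟨u1Deficit_nonneg _, u1Deficit_le_two _⟩)
  have hHint : Integrable (u1HiggsH (d := d) (L := L) g α) μ :=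
    Integrable.of_mem_Icc 0 _ (measurable_u1HiggsH g α).aemeasurable
      (ae_of_all _ fun U => ⟨u1HiggsH_nonneg g α U, u1HiggsH_le g α U⟩)
  -- `E[α² ∑ₓ t] ≤ E[H]`
  have h1 : ∫ U, α ^ 2 * ∑ z : Site d L, u1Deficit (U (z, i)) ∂μ ≤ ∫ U, u1HiggsH g α U ∂μ :=
    integral_mono ((integrable_finsetSum _ fun z _ => hint z).const_mul _) hHint
      fun U => sum_u1Deficit_dir_le_u1HiggsH g α i U
  rw [integral_const_mul, integral_finsetSum _ fun z _ => hint z] at h1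
  have h2 : ∑ z : Site d L, ∫ U, u1Deficit (U (z, i)) ∂μ =
      Fintype.card (Site d L) * ∫ U, u1Deficit (U (x, i)) ∂μ := by
    rw [Finset.sum_congr rfl fun z _ => integral_u1Deficit_edge_eq g α i z x, Finset.sum_const,
      Finset.card_univ, nsmul_eq_mul]
  rw [h2] at h1
  exact h1.trans (integral_u1HiggsH_le_log g α)

/-! ### Distances to `1` on the unit circle: the deficit of products (plaquettes) -/

/-- On the unit circle the distance to `1` is subadditive under products:
`|1 − zw| ≤ |1 − z| + |1 − w|` (`1 − zw = (1 − z) + z(1 − w)`, `|z| = 1`). [folklore] -/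
private theorem norm_one_sub_mul_le (z w : Circle) :
    ‖(1 : ℂ) - (z * w : Circle)‖ ≤ ‖(1 : ℂ) - z‖ + ‖(1 : ℂ) - w‖ := by
  have h : (1 : ℂ) - (z : ℂ) * w = (1 - z) + z * (1 - w) := by ring
  rw [Circle.coe_mul, h]
  refine (norm_add_le _ _).trans ?_
  rw [norm_mul, Circle.norm_coe, one_mul]

/-- `|1 − z⁻¹| = |1 − z|` on the unit circle (`z⁻¹ = z̄`). [folklore] -/
private theorem norm_one_sub_inv (z : Circle) : ‖(1 : ℂ) - (z⁻¹ : Circle)‖ = ‖(1 : ℂ) - z‖ := by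
  rw [Circle.coe_inv_eq_conj, ← Complex.norm_conj (1 - (z : ℂ)), map_sub, map_one]

/-- `|1 − z| = √(2 t(z))`. [folklore] -/
private theorem norm_one_sub_eq_sqrt (z : Circle) :
    ‖(1 : ℂ) - (z : ℂ)‖ = Real.sqrt (2 * u1Deficit z) := by
  rw [← norm_one_sub_coe_sq, Real.sqrt_sq (norm_nonneg _)]

omit [NeZero L] in
/-- **Plaquette bound** ("for any `U ∈ Σ'` and `p ∈ P`, `|1 − U_p| ≤ 4α⁻¹`", proof of Lemma 5.5,
verbatim for `U(1)`): if the four edge variables of a plaquette have deficit `≤ η`, the plaquette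
holonomy has deficit `≤ 16 η`. [cite: Chatterjee2026YMHiggs, §5.6 (proof of Lemma 5.10, as in Lemma 5.5)] -/
theorem u1Deficit_plaquetteHolonomy_le {η : ℝ} (hη : 0 ≤ η) (U : GaugeConfig d L Circle)
    (hU : ∀ e : Edge d L, u1Deficit (U e) ≤ η) (x : Site d L) (i j : Fin d) :
    u1Deficit (plaquetteHolonomy U x i j) ≤ 16 * η := by
  have hs : ∀ e : Edge d L, ‖(1 : ℂ) - (U e : ℂ)‖ ≤ Real.sqrt (2 * η) := fun e => by
    rw [norm_one_sub_eq_sqrt]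
    exact Real.sqrt_le_sqrt (by linarith [hU e])
  have key : ‖(1 : ℂ) - ((plaquetteHolonomy U x i j : Circle) : ℂ)‖ ≤ 4 * Real.sqrt (2 * η) := by
    unfold plaquetteHolonomy
    calc ‖(1 : ℂ) - ((U (x, i) * U (x.shift i, j) * (U (x.shift j, i))⁻¹ * (U (x, j))⁻¹ : Circle) : ℂ)‖
        ≤ ‖(1 : ℂ) - ((U (x, i) * U (x.shift i, j) * (U (x.shift j, i))⁻¹ : Circle) : ℂ)‖ +
            ‖(1 : ℂ) - ((U (x, j))⁻¹ : Circle)‖ := norm_one_sub_mul_le _ _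
      _ ≤ (‖(1 : ℂ) - ((U (x, i) * U (x.shift i, j) : Circle) : ℂ)‖ +
            ‖(1 : ℂ) - ((U (x.shift j, i))⁻¹ : Circle)‖) +
            ‖(1 : ℂ) - ((U (x, j))⁻¹ : Circle)‖ := by gcongr; exact norm_one_sub_mul_le _ _
      _ ≤ ((‖(1 : ℂ) - (U (x, i) : ℂ)‖ + ‖(1 : ℂ) - (U (x.shift i, j) : ℂ)‖) +
            ‖(1 : ℂ) - ((U (x.shift j, i))⁻¹ : Circle)‖) + ‖(1 : ℂ) - ((U (x, j))⁻¹ : Circle)‖ := by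
          gcongr; exact norm_one_sub_mul_le _ _
      _ ≤ ((Real.sqrt (2 * η) + Real.sqrt (2 * η)) + Real.sqrt (2 * η)) + Real.sqrt (2 * η) := by
          rw [norm_one_sub_inv, norm_one_sub_inv]
          gcongr <;> exact hs _
      _ = 4 * Real.sqrt (2 * η) := by ring
  have hsq : ‖(1 : ℂ) - ((plaquetteHolonomy U x i j : Circle) : ℂ)‖ ^ 2 ≤
      (4 * Real.sqrt (2 * η)) ^ 2 :=
    pow_le_pow_left₀ (norm_nonneg _) key 2
  rw [norm_one_sub_coe_sq, mul_pow, Real.sq_sqrt (by linarith)] at hsq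
  linarith

/-! ### The good set `Σ'` and the lower bound on the partition function -/

/-- The arc `T_η = {z ∈ U(1) : t(z) ≤ η}`. [cite: Chatterjee2026YMHiggs, §5.6 (the set Σ' of the proof of Lemma 5.5, for U(1))] -/
def u1DeficitBall (η : ℝ) : Set Circle := {z : Circle | u1Deficit z ≤ η}

/-- `T_η` is closed, hence measurable. [folklore] -/
private theorem measurableSet_u1DeficitBall (η : ℝ) : MeasurableSet (u1DeficitBall η) :=
  (isClosed_le continuous_u1Deficit continuous_const).measurableSet

/-- **Haar measure of the arc**: `Haar(T_η) ≥ √η/π` for `0 < η ≤ 1`: in the angle parametrisation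
(`CircleHaar.map_exp_angleMeasure`) `T_η ⊇ {|θ| ≤ √η}` since `1 − cos θ ≤ θ²/2`, an interval of
normalised length `2√η/(2π)` (the `U(1)` counterpart of the `S³`-volume count "the normalized Haar
measure of `Σ'` is `≥ (C₁α)^{−C₂Lᵈ}`"). [cite: Chatterjee2026YMHiggs, §5.6 (proof of Lemma 5.10, as in Lemma 5.5)] -/
theorem le_haar_u1DeficitBall {η : ℝ} (hη0 : 0 < η) (hη : η ≤ 1) :
    ENNReal.ofReal (Real.sqrt η / Real.pi) ≤ haarProbability Circle (u1DeficitBall η) := by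
  set s : ℝ := Real.sqrt η with hs
  have hs0 : 0 < s := Real.sqrt_pos.2 hη0
  have hs1 : s ≤ 1 := by rw [hs, ← Real.sqrt_one]; exact Real.sqrt_le_sqrt hη
  have hπ3 : (3 : ℝ) < Real.pi := Real.pi_gt_three
  have hsub : Set.Icc (-s) s ⊆ Circle.exp ⁻¹' u1DeficitBall η := by
    intro θ hθ
    simp only [Set.mem_preimage, u1DeficitBall, Set.mem_setOf_eq, u1Deficit]
    rw [Circle.coe_exp, Complex.exp_ofReal_mul_I_re]
    have hcos := Real.one_sub_sq_div_two_le_cos (x := θ)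
    have hθ2 : θ ^ 2 ≤ s ^ 2 := by nlinarith [hθ.1, hθ.2]
    have hs2 : s ^ 2 = η := Real.sq_sqrt hη0.le
    nlinarith
  have hIoc : Set.Icc (-s) s ⊆ Set.Ioc (-Real.pi) Real.pi := fun θ hθ =>
    ⟨by linarith [hθ.1], by linarith [hθ.2]⟩
  rw [← CircleHaar.map_exp_angleMeasure,
    Measure.map_apply Circle.exp.continuous.measurable (measurableSet_u1DeficitBall η)]
  refine le_trans (le_of_eq ?_) (measure_mono hsub)
  rw [CircleHaar.angleMeasure, Measure.smul_apply, smul_eq_mul,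
    Measure.restrict_apply measurableSet_Icc, Set.inter_eq_left.2 hIoc, Real.volume_Icc,
    ← ENNReal.ofReal_inv_of_pos (by positivity : (0 : ℝ) < 2 * Real.pi),
    ← ENNReal.ofReal_mul (inv_nonneg.2 (by positivity : (0 : ℝ) ≤ 2 * Real.pi))]
  congr 1
  field_simp
  ring

/-- The good set `Σ' = {U : t(U_e) ≤ η for all edges e}` (with `η = α⁻²`), a product of arcs.
[cite: Chatterjee2026YMHiggs, §5.6 (the set Σ' of the proof of Lemma 5.5, for U(1))] -/
def u1GoodSet (d L : ℕ) (η : ℝ) : Set (GaugeConfig d L Circle) :=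
  Set.pi Set.univ fun _ : Edge d L => u1DeficitBall η

omit [NeZero L] in
/-- Membership in `Σ'`: every edge variable lies in the arc. [folklore] -/
private theorem mem_u1GoodSet {η : ℝ} {U : GaugeConfig d L Circle} :
    U ∈ u1GoodSet d L η ↔ ∀ e : Edge d L, u1Deficit (U e) ≤ η := by
  simp [u1GoodSet, u1DeficitBall]

/-- `Σ'` is measurable (a finite product of closed sets). [folklore] -/
private theorem measurableSet_u1GoodSet (η : ℝ) : MeasurableSet (u1GoodSet d L η) :=
  MeasurableSet.univ_pi fun _ => measurableSet_u1DeficitBall η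

/-- **Product-Haar measure of `Σ'`**: `π(Σ') = Haar(T_η)^{|E|} ≥ (√η/π)^{|E|}`.
[cite: Chatterjee2026YMHiggs, §5.6 (proof of Lemma 5.10, as in Lemma 5.5)] -/
theorem le_u1HaarPi_goodSet {η : ℝ} (hη0 : 0 < η) (hη : η ≤ 1) :
    ENNReal.ofReal (Real.sqrt η / Real.pi) ^ Fintype.card (Edge d L) ≤
      u1HaarPi d L (u1GoodSet d L η) := by
  rw [u1HaarPi, u1GoodSet, Measure.pi_pi, Finset.prod_const, Finset.card_univ]
  exact pow_le_pow_left' (le_haar_u1DeficitBall hη0 hη) _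

/-- The sup of `H` on `Σ'`: `M(η) = g⁻² · 16η · |P| + α² · η · |E|`. [cite: Chatterjee2026YMHiggs, §5.6 (proof of Lemma 5.10: sup of H on Σ')] -/
def u1GoodSetSup (d L : ℕ) [NeZero L] (g α η : ℝ) : ℝ :=
  (g ^ 2)⁻¹ * (16 * η * Fintype.card (Plaquette d L)) + α ^ 2 * (η * Fintype.card (Edge d L))

/-- On `Σ'`, `H ≤ M(η)` (plaquette deficits `≤ 16η`, edge deficits `≤ η`). [cite: Chatterjee2026YMHiggs, §5.6 (proof of Lemma 5.10)] -/
theorem u1HiggsH_le_of_mem_goodSet {g α η : ℝ} (hη : 0 ≤ η) {U : GaugeConfig d L Circle}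
    (hU : U ∈ u1GoodSet d L η) : u1HiggsH g α U ≤ u1GoodSetSup d L g α η := by
  rw [mem_u1GoodSet] at hU
  unfold u1HiggsH u1GoodSetSup
  gcongr
  · calc ∑ p : Plaquette d L, u1Deficit (plaquetteHolonomy U p.1 p.2.1.1 p.2.1.2)
        ≤ ∑ _p : Plaquette d L, 16 * η :=
          Finset.sum_le_sum fun p _ => u1Deficit_plaquetteHolonomy_le hη U hU _ _ _
      _ = 16 * η * Fintype.card (Plaquette d L) := by
          rw [Finset.sum_const, Finset.card_univ, nsmul_eq_mul]; ring
  · calc ∑ e : Edge d L, u1Deficit (U e) ≤ ∑ _e : Edge d L, η := Finset.sum_le_sum fun e _ => hU e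
      _ = η * Fintype.card (Edge d L) := by
          rw [Finset.sum_const, Finset.card_univ, nsmul_eq_mul]; ring

/-- **Lower bound on the partition function**: `Z ≥ e^{−M(η)} (√η/π)^{|E|}` for `0 < η ≤ 1`
("`∫ p(U) ∏ dU_e ≥ e^{−C₁Lᵈ(αg)^{−2}} (C₂α)^{−C₃Lᵈ}`"). [cite: Chatterjee2026YMHiggs, §5.6 (proof of Lemma 5.10, as in Lemma 5.5)] -/
theorem le_u1GibbsZ (g α : ℝ) {η : ℝ} (hη0 : 0 < η) (hη : η ≤ 1) :
    ENNReal.ofReal (Real.exp (-u1GoodSetSup d L g α η)) *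
        ENNReal.ofReal (Real.sqrt η / Real.pi) ^ Fintype.card (Edge d L) ≤ u1GibbsZ d L g α := by
  rw [u1GibbsZ_eq_lintegral]
  calc ENNReal.ofReal (Real.exp (-u1GoodSetSup d L g α η)) *
        ENNReal.ofReal (Real.sqrt η / Real.pi) ^ Fintype.card (Edge d L)
      ≤ ENNReal.ofReal (Real.exp (-u1GoodSetSup d L g α η)) * u1HaarPi d L (u1GoodSet d L η) :=
        mul_le_mul_right (le_u1HaarPi_goodSet hη0 hη) _
    _ = ∫⁻ _U in u1GoodSet d L η, ENNReal.ofReal (Real.exp (-u1GoodSetSup d L g α η))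
          ∂u1HaarPi d L := by rw [setLIntegral_const]
    _ ≤ ∫⁻ U in u1GoodSet d L η, ENNReal.ofReal (Real.exp (-u1HiggsH g α U)) ∂u1HaarPi d L :=
        setLIntegral_mono' (measurableSet_u1GoodSet η) fun U hU =>
          ENNReal.ofReal_le_ofReal (Real.exp_le_exp.2
            (neg_le_neg (u1HiggsH_le_of_mem_goodSet hη0.le hU)))
    _ ≤ ∫⁻ U, ENNReal.ofReal (Real.exp (-u1HiggsH g α U)) ∂u1HaarPi d L :=
        setLIntegral_le_lintegral _ _

/-- **Logarithmic form**: `log (1/Z) ≤ M(η) + |E| log (π/√η)`. [cite: Chatterjee2026YMHiggs, §5.6 (proof of Lemma 5.10)] -/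
theorem log_inv_u1GibbsZ_le (g α : ℝ) {η : ℝ} (hη0 : 0 < η) (hη : η ≤ 1) :
    Real.log (((u1GibbsZ d L g α)⁻¹).toReal) ≤
      u1GoodSetSup d L g α η + Fintype.card (Edge d L) * Real.log (Real.pi / Real.sqrt η) := by
  set Z := u1GibbsZ d L g α with hZ
  set q : ℝ := Real.sqrt η / Real.pi with hq
  have hq0 : 0 < q := by rw [hq]; exact div_pos (Real.sqrt_pos.2 hη0) Real.pi_pos
  set z₀ : ℝ := Real.exp (-u1GoodSetSup d L g α η) * q ^ Fintype.card (Edge d L) with hz₀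
  have hz₀pos : 0 < z₀ := by positivity
  have hZge : ENNReal.ofReal z₀ ≤ Z := by
    rw [hz₀, ENNReal.ofReal_mul (Real.exp_pos _).le, ENNReal.ofReal_pow hq0.le]
    exact le_u1GibbsZ g α hη0 hη
  have hZ0 : Z ≠ 0 := u1GibbsZ_ne_zero g α
  have hZt : Z ≠ ∞ := u1GibbsZ_ne_top g α
  -- `(1/Z).toReal ≤ 1/z₀`
  have h1 : (Z⁻¹).toReal ≤ z₀⁻¹ := by
    have h := ENNReal.inv_le_inv.2 hZge
    rw [← ENNReal.ofReal_inv_of_pos hz₀pos] at h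
    have h' := ENNReal.toReal_mono ENNReal.ofReal_ne_top h
    rwa [ENNReal.toReal_ofReal (inv_nonneg.2 hz₀pos.le)] at h'
  have h2 : 0 < (Z⁻¹).toReal := ENNReal.toReal_pos (ENNReal.inv_ne_zero.2 hZt) (ENNReal.inv_ne_top.2 hZ0)
  calc Real.log ((Z⁻¹).toReal) ≤ Real.log (z₀⁻¹) := Real.log_le_log h2 h1
    _ = u1GoodSetSup d L g α η + Fintype.card (Edge d L) * Real.log (Real.pi / Real.sqrt η) := by
        rw [Real.log_inv, hz₀, Real.log_mul (Real.exp_pos _).ne' (pow_pos hq0 _).ne', Real.log_exp,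
          Real.log_pow, show Real.pi / Real.sqrt η = q⁻¹ by rw [hq, inv_div], Real.log_inv]
        ring

/-! ### Assembly: the key estimate -/

/-- **Chatterjee's key estimate for the unitary-gauge `U(1)` lattice Yang–Mills–Higgs measure
(Lemma 5.10), explicit form.** For every dimension `d`, torus side `L ≥ 1`, Higgs length `α ≥ 1`,
every gauge coupling `g` (junk `β = 0` at `g = 0` included) and every edge `(x, i)`,

  `E_{u1HiggsMeasure}[1 − Re U_{(x,i)}] ≤ 16 d² / (g² α⁴) + (d + d log (π α)) / α²`,

uniformly in the volume. Proof exactly as the tree's `SU(2)` version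
`integral_su2Deficit_le_keyEstimate` ("exactly like in the proof of Lemma 5.5", §5.6):
Jensen `E[H] ≤ log(1/Z)`, `Z ≥ e^{−sup_{Σ'} H} π(Σ')` with `Σ' = {t(U_e) ≤ α⁻² ∀e}`,
`sup_{Σ'} H ≤ g⁻² 16α⁻²|P| + |E|`, `π(Σ') ≥ (α⁻¹/π)^{|E|}`, and `α² Lᵈ E[t(U_{(x,i)})] ≤ E[H]` by
translation invariance. [cite: Chatterjee2026YMHiggs, Lemma 5.10 (§5.6)] -/
theorem integral_u1Deficit_le_keyEstimate {α : ℝ} (hα : 1 ≤ α) (g : ℝ) (x : Site d L) (i : Fin d) :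
    ∫ U, u1Deficit (U (x, i)) ∂u1HiggsMeasure (d := d) L g α ≤
      16 * d ^ 2 / (g ^ 2 * α ^ 4) + (d + d * Real.log (Real.pi * α)) / α ^ 2 := by
  set m := ∫ U, u1Deficit (U (x, i)) ∂u1HiggsMeasure (d := d) L g α with hm
  set S : ℝ := (Fintype.card (Site d L) : ℝ) with hSdef
  have hS : 0 < S := by rw [hSdef]; exact_mod_cast Fintype.card_pos
  have hα0 : 0 < α := lt_of_lt_of_le one_pos hα
  have hα2 : 0 < α ^ 2 := by positivity
  set η : ℝ := (α ^ 2)⁻¹ with hη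
  have hη0 : 0 < η := inv_pos.2 hα2
  have hη1 : η ≤ 1 := by
    rw [hη]
    exact inv_le_one_of_one_le₀ (by nlinarith)
  -- the two halves of the argument
  have h1 := card_mul_integral_u1Deficit_le (d := d) (L := L) g α i x
  have h2 := log_inv_u1GibbsZ_le (d := d) (L := L) g α hη0 hη1
  have key : α ^ 2 * (S * m) ≤ u1GoodSetSup d L g α η +
      Fintype.card (Edge d L) * Real.log (Real.pi / Real.sqrt η) := h1.trans h2
  -- cardinalities and `log (π/√η) = log (π α)`
  have hsqrt : Real.sqrt η = α⁻¹ := by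
    rw [hη, ← inv_pow, Real.sqrt_sq (inv_nonneg.2 hα0.le)]
  have hlog : Real.log (Real.pi / Real.sqrt η) = Real.log (Real.pi * α) := by
    rw [hsqrt, div_inv_eq_mul]
  have hE := card_edge (d := d) (L := L)
  have hP := card_plaquette_le (d := d) (L := L)
  have hg2 : 0 ≤ (g ^ 2)⁻¹ := inv_nonneg.2 (by positivity)
  have key' : α ^ 2 * (S * m) ≤ (g ^ 2)⁻¹ * (16 * η * (S * d ^ 2)) +
      α ^ 2 * (η * (S * d)) + S * d * Real.log (Real.pi * α) := by
    refine key.trans ?_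
    unfold u1GoodSetSup
    rw [hE, hlog, ← hSdef]
    have : (g ^ 2)⁻¹ * (16 * η * (Fintype.card (Plaquette d L) : ℝ)) ≤
        (g ^ 2)⁻¹ * (16 * η * (S * d ^ 2)) := by
      gcongr
    linarith
  -- divide by `α² S > 0`
  have key'' : α ^ 2 * S * m ≤
      α ^ 2 * S * (16 * d ^ 2 / (g ^ 2 * α ^ 4) + (d + d * Real.log (Real.pi * α)) / α ^ 2) := by
    rw [mul_assoc]
    refine key'.trans (le_of_eq ?_)
    rw [hη]
    rcases eq_or_ne g 0 with hg | hg
    · subst hg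
      field_simp
      ring
    · field_simp
      ring
  exact le_of_mul_le_mul_left key'' (by positivity)

/-- **Lemma 5.10** (Chatterjee), PROVED — discharge of the named fact `u1Higgs_keyEstimate`:
for `d ≥ 2` there is `C = C(d)` (here `C = 32 d² + 2d + 2d (1 + log π)/log 2`) such that for every
torus side `L ≥ 1`, `g > 0`, `α ≥ 2` with `αg ≤ 1` and every edge `e`,
`E|1 − U_e|² ≤ C/(α⁴g²) + C log α/α²` under `u1HiggsMeasure L g α` — from the explicit form
`integral_u1Deficit_le_keyEstimate` via `|1 − z|² = 2 (1 − Re z)` and `log α ≥ log 2` for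
`α ≥ 2` (the hypotheses `d ≥ 2`, `αg ≤ 1` are not used). [cite: Chatterjee2026YMHiggs, Lemma 5.10 (§5.6); proof via Lemma 5.5 (§5.3)] -/
theorem u1Higgs_keyEstimate_holds : u1Higgs_keyEstimate := by
  intro d _
  refine ⟨32 * (d : ℝ) ^ 2 + 2 * d + 2 * d * (1 + Real.log Real.pi) / Real.log 2, ?_⟩
  intro L _ g α hg hα _ e
  obtain ⟨x, i⟩ := e
  set μ := u1HiggsMeasure (d := d) L g α with hμ
  have hm := integral_u1Deficit_le_keyEstimate (d := d) (L := L) (by linarith : (1 : ℝ) ≤ α) g x i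
  -- `E|1 − U_e|² = 2 E[t(U_e)]`
  have hint : ∫ U, ‖(1 : ℂ) - ((U (x, i) : Circle) : ℂ)‖ ^ 2 ∂μ =
      2 * ∫ U, u1Deficit (U (x, i)) ∂μ := by
    rw [← integral_const_mul]
    exact integral_congr_ae (ae_of_all _ fun U => norm_one_sub_coe_sq (U (x, i)))
  rw [hint]
  -- constants
  have hα0 : 0 < α := by linarith
  have hd : (0 : ℝ) ≤ d := Nat.cast_nonneg d
  have hℓ2 : 0 < Real.log 2 := Real.log_pos one_lt_two
  have hℓ : Real.log 2 ≤ Real.log α := Real.log_le_log two_pos hα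
  have hℓπ : 0 < 1 + Real.log Real.pi :=
    add_pos_of_pos_of_nonneg one_pos (Real.log_nonneg (by linarith [Real.pi_gt_three]))
  have hlogmul : Real.log (Real.pi * α) = Real.log Real.pi + Real.log α :=
    Real.log_mul Real.pi_pos.ne' hα0.ne'
  set C : ℝ := 32 * (d : ℝ) ^ 2 + 2 * d + 2 * d * (1 + Real.log Real.pi) / Real.log 2 with hC
  set q : ℝ := 2 * d * (1 + Real.log Real.pi) / Real.log 2 with hq
  have hq0 : 0 ≤ q := by positivity
  have hqℓ : q * Real.log 2 = 2 * d * (1 + Real.log Real.pi) := by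
    rw [hq]; field_simp
  -- first term
  have hT1 : 2 * (16 * (d : ℝ) ^ 2 / (g ^ 2 * α ^ 4)) ≤ C / (α ^ 4 * g ^ 2) := by
    rw [mul_comm (α ^ 4), ← mul_div_assoc]
    apply div_le_div_of_nonneg_right _ (by positivity)
    rw [hC]
    nlinarith
  -- second term
  have hT2 : 2 * ((d + d * Real.log (Real.pi * α)) / α ^ 2) ≤ C * Real.log α / α ^ 2 := by
    rw [← mul_div_assoc]
    apply div_le_div_of_nonneg_right _ (by positivity)
    rw [hlogmul, hC]
    have h1 : q * Real.log 2 ≤ q * Real.log α := mul_le_mul_of_nonneg_left hℓ hq0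
    have h2 : 0 ≤ 32 * (d : ℝ) ^ 2 * Real.log α := by
      have : 0 ≤ Real.log α := hℓ2.le.trans hℓ
      positivity
    have hCexp : (32 * (d : ℝ) ^ 2 + 2 * d + 2 * d * (1 + Real.log Real.pi) / Real.log 2) * Real.log α
        = 32 * (d : ℝ) ^ 2 * Real.log α + 2 * d * Real.log α + q * Real.log α := by
      rw [hq]; ring
    rw [hCexp]
    nlinarith
  calc 2 * ∫ U, u1Deficit (U (x, i)) ∂μ
      ≤ 2 * (16 * (d : ℝ) ^ 2 / (g ^ 2 * α ^ 4) + (d + d * Real.log (Real.pi * α)) / α ^ 2) :=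
        mul_le_mul_of_nonneg_left hm (by norm_num)
    _ = 2 * (16 * (d : ℝ) ^ 2 / (g ^ 2 * α ^ 4)) + 2 * ((d + d * Real.log (Real.pi * α)) / α ^ 2) := by
        ring
    _ ≤ C / (α ^ 4 * g ^ 2) + C * Real.log α / α ^ 2 := add_le_add hT1 hT2

end Literature.MathematicalPhysics.QuantumFieldTheory.Chatterjee2026YMHiggs
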